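import Mathlib
import Literature.NumberTheory.LFunctions.WeilExplicit
import Literature.NumberTheory.LFunctions.WeilGroundEnergyProofs
import Literature.NumberTheory.LFunctions.WeilGroundState
import HarnessLib

/-!
# RiemannHypothesis / WeilGroundState — weighted `L¹` convergence of a minimising sequence

Route `RiemannHypothesis/WeilGroundState`, crux item stmt-RiemannHypothesis-1527
(`GroundStatesConvergeToXi`), line `Sketch`, registered sub-goal (L)
`tendsto_integral_norm_mul_exp_of_minimizingSeq` (helper file, `--supports`).

**Statement.** Let `u` be an operator-free Weil ground state at window `a`
(`IsWeilGroundState a u`) and let `gₙ` be `L²`-normalised test functions on the window,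
`tsupport gₙ ⊆ [-a, a]`, with `∫ |gₙ − u|² → 0`. Then for every real `b` the exponentially
weighted `L¹` norms converge: `∫ |gₙ(t)| e^{b|t|} dt → ∫ |u(t)| e^{b|t|} dt`.

**Proof.** Everything lives on the compact window: `gₙ` vanishes off `[-a, a]` (support) and so
does `u` a.e. (`IsWeilGroundState.ae_eq_zero_of_notMem`). Hence, with `M = e^{|b| a}` bounding
the weight on the window and `χ` the indicator of the window,
`|∫|gₙ|w − ∫|u|w| ≤ ∫ ||gₙ| − |u|| w ≤ M ∫ |gₙ − u| = M ∫ |gₙ − u| |χ| ≤ M √(∫|gₙ − u|²) ‖χ‖₂ → 0`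
(reverse triangle inequality, then Cauchy–Schwarz `integral_mul_norm_le_Lp_mul_Lq` at
`p = q = 2`), and `squeeze_zero` concludes.

Mathlib + `Literature.NumberTheory.LFunctions.WeilGroundState` API only; no named fact is used;
no definitions.
-/

noncomputable section

set_option linter.dupNamespace false

open MeasureTheory Complex Filter Set
open scoped Real Topology ENNReal

namespace Summit.RiemannHypothesis.RiemannHypothesis.Theorems.GroundStatesConvergeToXi

open Literature.NumberTheory.LFunctions

/-- **The weight is bounded on the window**: `e^{b|t|} ≤ e^{|b| a}` for `t ∈ [-a, a]`. [folklore] -/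
theorem weightedL1_exp_le_of_mem_Icc {a b t : ℝ} (ht : t ∈ Icc (-a) a) :
    Real.exp (b * |t|) ≤ Real.exp (|b| * a) := by
  have hta : |t| ≤ a := abs_le.2 ⟨ht.1, ht.2⟩
  exact Real.exp_le_exp.2 <|
    calc b * |t| ≤ |b| * |t| := mul_le_mul_of_nonneg_right (le_abs_self b) (abs_nonneg t)
      _ ≤ |b| * a := mul_le_mul_of_nonneg_left hta (abs_nonneg b)

/-- **`L¹ ≤ √(2a) · L²` on the window, a.e.-supported form.** If `v ∈ L²(ℝ)` vanishes a.e. off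
`[-a, a]`, then `∫ |v| ≤ √(∫ |v|²) · ‖χ_{[-a,a]}‖₂` (Cauchy–Schwarz against the indicator of the
window). [folklore] -/
theorem weightedL1_integral_norm_le_sqrt {a : ℝ} {v : ℝ → ℂ} (hv : MemLp v 2)
    (hv0 : ∀ᵐ t : ℝ, t ∉ Icc (-a) a → v t = 0) :
    ∫ t, ‖v t‖ ≤ Real.sqrt (∫ t, ‖v t‖ ^ 2) *
      (∫ t, ‖(Icc (-a) a).indicator (fun _ => (1 : ℂ)) t‖ ^ (2 : ℝ)) ^ (1 / (2 : ℝ)) := by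
  set χ : ℝ → ℂ := (Icc (-a) a).indicator fun _ => (1 : ℂ) with hχ
  have hχm : MemLp χ (ENNReal.ofReal 2) volume := by
    rw [ENNReal.ofReal_ofNat]
    exact memLp_indicator_const 2 measurableSet_Icc (1 : ℂ) (Or.inr measure_Icc_lt_top.ne)
  have hvm : MemLp v (ENNReal.ofReal 2) volume := by
    rw [ENNReal.ofReal_ofNat]
    exact hv
  have hae : (fun t => ‖v t‖) =ᵐ[volume] fun t => ‖v t‖ * ‖χ t‖ := by
    filter_upwards [hv0] with t ht
    by_cases hmem : t ∈ Icc (-a) a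
    · simp [hχ, hmem]
    · simp [hχ, hmem, ht hmem]
  rw [integral_congr_ae hae]
  have hCS := integral_mul_norm_le_Lp_mul_Lq (μ := volume) (f := v) (g := χ)
    Real.HolderConjugate.two_two hvm hχm
  have hsq : (∫ t, ‖v t‖ ^ (2 : ℝ)) ^ (1 / (2 : ℝ)) = Real.sqrt (∫ t, ‖v t‖ ^ 2) := by
    rw [Real.sqrt_eq_rpow]
    simp_rw [Real.rpow_two]
  rw [hsq] at hCS
  exact hCS

/-- (L) **Weighted `L¹` convergence of the minimising sequence.** For a ground state `u` at
window `a` and `L²`-normalised window test functions `gₙ → u` in `L²`, every exponentially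
weighted `L¹` norm converges: `∫ |gₙ| e^{b|t|} → ∫ |u| e^{b|t|}` (everything lives on the compact
window `[-a, a]`, where `e^{b|t|} ≤ e^{|b| a}` and `‖·‖₁ ≤ √(2a) ‖·‖₂`). [folklore] -/
theorem tendsto_integral_norm_mul_exp_of_minimizingSeq {a : ℝ} {u : ℝ → ℂ} {g : ℕ → ℝ → ℂ}
    (hGS : IsWeilGroundState a u)
    (hg : ∀ n, IsWeilTest (g n) ∧ tsupport (g n) ⊆ Icc (-a) a ∧ ∫ t, ‖g n t‖ ^ 2 = (1 : ℝ))
    (hL : Tendsto (fun n => ∫ t, ‖g n t - u t‖ ^ 2) atTop (𝓝 0)) (b : ℝ) :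
    Tendsto (fun n => ∫ t, ‖g n t‖ * Real.exp (b * |t|)) atTop
      (𝓝 (∫ t, ‖u t‖ * Real.exp (b * |t|))) := by
  -- the weight, its bound on the window, and the Cauchy–Schwarz constant
  have hw : Continuous fun t : ℝ => Real.exp (b * |t|) := by fun_prop
  set M : ℝ := Real.exp (|b| * a) with hM_def
  have hM : 0 ≤ M := (Real.exp_pos _).le
  set K : ℝ := (∫ t, ‖(Icc (-a) a).indicator (fun _ => (1 : ℂ)) t‖ ^ (2 : ℝ)) ^ (1 / (2 : ℝ))
    with hK_def
  -- support, `L²` and integrability bookkeeping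
  have hg0 : ∀ n t, t ∉ Icc (-a) a → g n t = 0 := fun n t ht =>
    image_eq_zero_of_notMem_tsupport fun h' => ht ((hg n).2.1 h')
  have hgm : ∀ n, MemLp (g n) 2 := fun n =>
    (hg n).1.1.continuous.memLp_of_hasCompactSupport (hg n).1.2
  have hvm : ∀ n, MemLp (fun t => g n t - u t) 2 := fun n => (hgm n).sub hGS.memLp
  have hv0 : ∀ n, ∀ᵐ t : ℝ, t ∉ Icc (-a) a → g n t - u t = 0 := fun n =>
    hGS.ae_eq_zero_of_notMem.mono fun t ht hts => by simp [hg0 n t hts, ht hts]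
  have hvi : ∀ n, Integrable (fun t => g n t - u t) := fun n =>
    ((hg n).1.1.continuous.integrable_of_hasCompactSupport (hg n).1.2).sub hGS.integrable
  have hgi : ∀ n, Integrable (fun t => ‖g n t‖ * Real.exp (b * |t|)) := fun n =>
    ((hg n).1.1.continuous.norm.mul hw).integrable_of_hasCompactSupport
      (hg n).1.2.norm.mul_right
  have hui : Integrable (fun t => ‖u t‖ * Real.exp (b * |t|)) :=
    (IntegrableOn.mul_continuousOn hGS.integrableOn.norm hw.continuousOn
      isCompact_Icc).integrable_of_ae_notMem_eq_zero
        (hGS.ae_eq_zero_of_notMem.mono fun t ht hts => by simp [ht hts])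
  -- the key estimate `|∫|gₙ|w − ∫|u|w| ≤ M · √(∫|gₙ − u|²) · K`
  have hkey : ∀ n, ‖(∫ t, ‖g n t‖ * Real.exp (b * |t|)) - ∫ t, ‖u t‖ * Real.exp (b * |t|)‖ ≤
      M * (Real.sqrt (∫ t, ‖g n t - u t‖ ^ 2) * K) := fun n => by
    rw [← integral_sub (hgi n) hui]
    calc ‖∫ t, (‖g n t‖ * Real.exp (b * |t|) - ‖u t‖ * Real.exp (b * |t|))‖
        ≤ ∫ t, M * ‖g n t - u t‖ := by
          refine norm_integral_le_of_norm_le ((hvi n).norm.const_mul M) ?_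
          filter_upwards [hGS.ae_eq_zero_of_notMem] with t ht
          by_cases hmem : t ∈ Icc (-a) a
          · rw [← sub_mul, norm_mul, Real.norm_eq_abs, Real.norm_eq_abs,
              abs_of_pos (Real.exp_pos _), mul_comm M]
            exact mul_le_mul (abs_norm_sub_norm_le _ _) (weightedL1_exp_le_of_mem_Icc hmem)
              (Real.exp_pos _).le (norm_nonneg _)
          · simp [hg0 n t hmem, ht hmem]
      _ = M * ∫ t, ‖g n t - u t‖ := integral_const_mul _ _
      _ ≤ M * (Real.sqrt (∫ t, ‖g n t - u t‖ ^ 2) * K) :=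
          mul_le_mul_of_nonneg_left (weightedL1_integral_norm_le_sqrt (hvm n) (hv0 n)) hM
  -- squeeze
  rw [tendsto_iff_norm_sub_tendsto_zero]
  refine squeeze_zero (fun n => norm_nonneg _) hkey ?_
  have hlim : Tendsto (fun n => M * (Real.sqrt (∫ t, ‖g n t - u t‖ ^ 2) * K)) atTop
      (𝓝 (M * (Real.sqrt 0 * K))) :=
    (hL.sqrt.mul_const K).const_mul M
  simpa only [Real.sqrt_zero, zero_mul, mul_zero] using hlim

end Summit.RiemannHypothesis.RiemannHypothesis.Theorems.GroundStatesConvergeToXi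

end
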